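import Mathlib
import Summits.Ventures.PercRepro2.StarGlue
import Summits.Ventures.PercRepro2.TypedFactor
import Summits.Ventures.PercRepro2.TypedSepThreeSym
import Summits.Ventures.PercRepro2.TypedSplit
import Summits.Ventures.PercRepro2.TypedUntouched
import Summits.Ventures.PercRepro2.HCovTyped
import Summits.Ventures.PercRepro2.OStarGlueSum
import Summits.Ventures.PercRepro2.OStarCert

/-!
# The gluing lemma for the star of `o`, and row 2′TRI when `o` is adjacent only to `a₁, a₂, b`
(blind cell PercRepro2, mine-2 g39, 2026-08-28; `proofs/MINE2-GLUE.md` §3, row M2-83 — part III)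

On the support of a typed count `K₃` is a SIDE KERNEL (`K3_eq_side`: `KB` on the glued states,
the `A`-side the typed star edges, the `B`-side the other typed edges; part I), which may be
symmetrised over the `B`-copies (p3's `six_mul_typedCount_sideB`, giving `PSYM`: `symB_Φ`); with
the product of the typed triples of the two sides and the placement sum of the star (part II),
**`six_mul_typedCount_eq`** — SIX TIMES THE TYPED COUNT IS THE SUM, OVER THE TYPED TRIPLES OF THE
REST, OF THE GADGET SUM `C t₁ t₂ t_b` AT THE REST'S PATTERN TRIPLE, the typing `t` of the star read
off `F, z, τ`.  With the kernel-decided certificate `C_nonneg` (`OStarCert.lean`):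
**`typedCount_nonneg_of_star`** — row 2′TRI holds for every typed set, pinning and typing on every
finite graph in which every edge at `o` leads to `a₁`, `a₂` or `b` (at most one edge to each);
**`TypedBases_of_star`** and **`HCov_of_star`** — (HCOV) for every admissible weight vector on that
family (`HCov_of_typedBases`).  The family contains the `o`-patterns `{b}, {a₁, b}, {a₂, b},
{a₁, a₂, b}` of `proofs/MINE2-GADGET.md` §7 (and the separation zeros `{a₁}, {a₂}, {a₁, a₂}`); the
same gluing with another finite certificate gives every local certificate of that note.  Own
code; standard axioms.
-/

namespace Summit.Ventures.PercRepro2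

open UnionCluster

namespace CovForm

namespace OStar

open OneTyped Untouched TypedFactor SepThree TypedRed StarGlue

/-! ## `K₃` on the support is a side kernel -/

section Side

variable {V : Type*} {E : Type*} [DecidableEq V] [DecidableEq E]
variable (ends : E → Sym2 V) (o a₁ a₂ a₃ b : V) [DecidablePred (· ∈ (touches ends {o})ᶜ)]
  (e₁ e₂ eb : Option E) {R : Type*} [Field R]

/-- The kernel on the side restrictions: `KB` on the glued states. -/
noncomputable def Φ : Config E → Config E → Config E → Config E → Config E → Config E → R :=
  fun xa ya wa xb yb wb =>
    ((KB (S (pat ends o a₁ a₂ a₃ b xb) (nbr e₁ e₂ eb xa))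
      (S (pat ends o a₁ a₂ a₃ b yb) (nbr e₁ e₂ eb ya))
      (S (pat ends o a₁ a₂ a₃ b wb) (nbr e₁ e₂ eb wa)) : ℤ) : R)

variable {ends o a₁ a₂ a₃ b e₁ e₂ eb}

/-- **`K₃` on the support is the side kernel of `Φ`.** -/
theorem K3_eq_side (hS : Star ends o a₁ a₂ a₃ b e₁ e₂ eb) (F : Finset E) (z : Config E)
    {x y w : Config E} (hx : ∀ e, e ∉ F → x e = z e) (hy : ∀ e, e ∉ F → y e = z e)
    (hw : ∀ e, e ∉ F → w e = z e) :
    (K3 ends o a₁ a₂ a₃ b x y w : R) =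
      sideKernel (sideA ends o F) (sideB ends o F) z (Φ ends o a₁ a₂ a₃ b e₁ e₂ eb) x y w := by
  rw [K3_eq_KB, hS.st_eq_S x, hS.st_eq_S y, hS.st_eq_S w]
  unfold sideKernel Φ
  rw [nbr_restr_sideA hS hx, nbr_restr_sideA hS hy, nbr_restr_sideA hS hw, pat_restr_sideB hx,
    pat_restr_sideB hy, pat_restr_sideB hw]

omit [DecidableEq V] [DecidableEq E] in
/-- The `B`-symmetrisation of `Φ` is the pattern-symmetrised kernel `PSYM`. -/
lemma symB_Φ (xa ya wa xb yb wb : Config E) :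
    symB (Φ ends o a₁ a₂ a₃ b e₁ e₂ eb) xa ya wa xb yb wb =
      ((PSYM (nbr e₁ e₂ eb xa) (nbr e₁ e₂ eb ya) (nbr e₁ e₂ eb wa) (pat ends o a₁ a₂ a₃ b xb)
        (pat ends o a₁ a₂ a₃ b yb) (pat ends o a₁ a₂ a₃ b wb) : ℤ) : R) := by
  unfold symB Φ PSYM
  push_cast
  ring

end Side

/-! ## The gluing theorem and row 2′TRI on the star family -/

section Main

variable {V : Type*} {E : Type*} [Fintype E] [DecidableEq V] [DecidableEq E]
variable {ends : E → Sym2 V} {o a₁ a₂ a₃ b : V} [DecidablePred (· ∈ (touches ends {o})ᶜ)]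
  {e₁ e₂ eb : Option E} {R : Type*} [Field R] [LinearOrder R] [IsStrictOrderedRing R]

omit [LinearOrder R] [IsStrictOrderedRing R] in
/-- The cast of the gadget sum is the `plc` sum of the casts. -/
lemma cast_C (t₁ t₂ tb : ℕ) (P₁ P₂ P₃ : Pat) :
    ((C t₁ t₂ tb P₁ P₂ P₃ : ℤ) : R) =
      ((plc t₁).map fun c₁ => ((plc t₂).map fun c₂ => ((plc tb).map fun cb =>
        ((PSYM (c₁.1, c₂.1, cb.1) (c₁.2.1, c₂.2.1, cb.2.1) (c₁.2.2, c₂.2.2, cb.2.2)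
          P₁ P₂ P₃ : ℤ) : R)).sum).sum).sum := by
  simp only [C, Int.cast_list_sum, List.map_map, Function.comp_def]

omit [Fintype E] [DecidablePred (· ∈ (touches ends {o})ᶜ)] in
/-- The type of a star slot is at most `3`. -/
lemma typ_le_three {F : Finset E} {z : Config E} {τ : E → ℕ} (hτ : ∀ e ∈ F, τ e = 1 ∨ τ e = 2)
    (s : Option E) : typ s (sideA ends o F) z τ ≤ 3 := by
  cases s with
  | none => exact Nat.zero_le 3
  | some e =>
    simp only [typ]
    split_ifs with h1 h2
    · rcases hτ e (mem_sideA.1 h1).1 with h | h <;> omega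
    · exact le_refl 3
    · exact Nat.zero_le 3

omit [LinearOrder R] [IsStrictOrderedRing R] in
/-- **THE GLUING THEOREM**: six times the typed count of `K₃` is the sum, over the typed triples of
the rest, of the gadget sum of the star's typing at the rest's pattern triple. -/
theorem six_mul_typedCount_eq (hS : Star ends o a₁ a₂ a₃ b e₁ e₂ eb) (F : Finset E)
    (z : Config E) (τ : E → ℕ) :
    6 * typedCount F z τ (K3 ends o a₁ a₂ a₃ b : Config E → Config E → Config E → R) =
      ∑ xb : Config E, ∑ yb : Config E, ∑ wb : Config E,
        if cond (sideB ends o F) z τ xb yb wb then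
          ((C (typ e₁ (sideA ends o F) z τ) (typ e₂ (sideA ends o F) z τ)
            (typ eb (sideA ends o F) z τ) (pat ends o a₁ a₂ a₃ b xb) (pat ends o a₁ a₂ a₃ b yb)
            (pat ends o a₁ a₂ a₃ b wb) : ℤ) : R)
        else 0 := by
  have hside : typedCount F z τ (K3 ends o a₁ a₂ a₃ b : Config E → Config E → Config E → R) =
      typedCount F z τ (sideKernel (sideA ends o F) (sideB ends o F) z
        (Φ ends o a₁ a₂ a₃ b e₁ e₂ eb)) :=
    typedCount_congr_on_support F z τ fun x y w hc _ =>
      K3_eq_side hS F z (fun e he => (hc e he).1) (fun e he => (hc e he).2.1)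
        (fun e he => (hc e he).2.2)
  rw [hside, six_mul_typedCount_sideB F (sideB_subset F) (disjoint_sideA_sideB F) z τ]
  have hU := typedCount_eq_sum_AB (sideA ends o F) (sideB ends o F) (disjoint_sideA_sideB F) z τ
    (sideKernel (sideA ends o F) (sideB ends o F) z (symB (Φ (R := R) ends o a₁ a₂ a₃ b e₁ e₂ eb)))
  rw [sideA_union_sideB] at hU
  rw [hU]
  refine Finset.sum_congr rfl fun xb _ => Finset.sum_congr rfl fun yb _ =>
    Finset.sum_congr rfl fun wb _ => ?_
  by_cases hB : cond (sideB ends o F) z τ xb yb wb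
  · rw [if_pos hB]
    have hinner : ∀ xa ya wa : Config E,
        (if cond (sideA ends o F) z τ xa ya wa ∧ cond (sideB ends o F) z τ xb yb wb then
          sideKernel (sideA ends o F) (sideB ends o F) z (symB (Φ ends o a₁ a₂ a₃ b e₁ e₂ eb))
            (merge (sideA ends o F) (sideB ends o F) z xa xb)
            (merge (sideA ends o F) (sideB ends o F) z ya yb)
            (merge (sideA ends o F) (sideB ends o F) z wa wb) else 0) =
        if cond (sideA ends o F) z τ xa ya wa then
          ((PSYM (nbr e₁ e₂ eb xa) (nbr e₁ e₂ eb ya) (nbr e₁ e₂ eb wa) (pat ends o a₁ a₂ a₃ b xb)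
            (pat ends o a₁ a₂ a₃ b yb) (pat ends o a₁ a₂ a₃ b wb) : ℤ) : R) else 0 := by
      intro xa ya wa
      by_cases hA : cond (sideA ends o F) z τ xa ya wa
      · rw [if_pos ⟨hA, hB⟩, if_pos hA]
        unfold sideKernel
        rw [restr_merge_left (fun e he => (hA.1 e he).1), restr_merge_left (fun e he => (hA.1 e he).2.1),
          restr_merge_left (fun e he => (hA.1 e he).2.2),
          restr_merge_right (disjoint_sideA_sideB F) (fun e he => (hB.1 e he).1),
          restr_merge_right (disjoint_sideA_sideB F) (fun e he => (hB.1 e he).2.1),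
          restr_merge_right (disjoint_sideA_sideB F) (fun e he => (hB.1 e he).2.2), symB_Φ]
      · rw [if_neg (fun h => hA h.1), if_neg hA]
    refine (Finset.sum_congr rfl fun xa _ => Finset.sum_congr rfl fun ya _ =>
      Finset.sum_congr rfl fun wa _ => hinner xa ya wa).trans ?_
    rw [← typedCount_eq_sum_cond, typedCount_star_eq hS (fun e he => (mem_sideA.1 he).2) z τ
      (fun N₁ N₂ N₃ => ((PSYM N₁ N₂ N₃ (pat ends o a₁ a₂ a₃ b xb) (pat ends o a₁ a₂ a₃ b yb)
        (pat ends o a₁ a₂ a₃ b wb) : ℤ) : R)), cast_C]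
  · rw [if_neg hB]
    refine Finset.sum_eq_zero fun xa _ => Finset.sum_eq_zero fun ya _ =>
      Finset.sum_eq_zero fun wa _ => ?_
    rw [if_neg (fun h => hB h.2)]

/-- **Row 2′TRI on the star family**: when every edge at `o` leads to `a₁`, `a₂` or `b` (at most
one edge to each), every typed base of `K₃` is nonnegative. -/
theorem typedCount_nonneg_of_star (hS : Star ends o a₁ a₂ a₃ b e₁ e₂ eb) (F : Finset E)
    (z : Config E) (τ : E → ℕ) (hτ : ∀ e ∈ F, τ e = 1 ∨ τ e = 2) :
    0 ≤ typedCount F z τ (K3 ends o a₁ a₂ a₃ b : Config E → Config E → Config E → R) := by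
  have h6 : 0 ≤ 6 * typedCount F z τ (K3 ends o a₁ a₂ a₃ b : Config E → Config E → Config E → R) := by
    rw [six_mul_typedCount_eq hS F z τ]
    refine Finset.sum_nonneg fun xb _ => Finset.sum_nonneg fun yb _ =>
      Finset.sum_nonneg fun wb _ => ?_
    split_ifs
    · exact Int.cast_nonneg (C_nonneg (typ_le_three hτ e₁) (typ_le_three hτ e₂)
        (typ_le_three hτ eb) (valid_pat xb) (valid_pat yb) (valid_pat wb))
    · exact le_refl 0
  exact (mul_nonneg_iff_of_pos_left (by norm_num : (0 : R) < 6)).1 h6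

/-- **The typed bases on the star family** (row 2′TRI as a class theorem). -/
theorem TypedBases_of_star (hS : Star ends o a₁ a₂ a₃ b e₁ e₂ eb) :
    TypedBases (R := R) ends o a₁ a₂ a₃ b :=
  fun F z τ hτ => typedCount_nonneg_of_star hS F z τ hτ

/-- **(HCOV) on the star family** for every admissible weight vector. -/
theorem HCov_of_star (hS : Star ends o a₁ a₂ a₃ b e₁ e₂ eb) (p : E → R) (hp : IsProbVec p) :
    HCov p ends o a₁ a₂ a₃ b :=
  HCov_of_typedBases ends o a₁ a₂ a₃ b (TypedBases_of_star hS) p hp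

end Main

end OStar

end CovForm

end Summit.Ventures.PercRepro2
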